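import Literature.NumberTheory.IwasawaTheory.NarrowFukudaRankLayer
import Literature.NumberTheory.IwasawaTheory.ZpExtensionLayerRamificationDichotomy
import Literature.NumberTheory.IwasawaTheory.ZpExtensionLayerTotallyRamifiedPrime
import Literature.NumberTheory.NumberFields.BigHilbertClassFieldOfGaloisExtension
import Literature.NumberTheory.EllipticCurves.ZpExtensionLayerCharacter
import HarnessLib

/-!
# Narrow Fukuda (Thm. 1 (2) for narrow class groups) at finite level — the PACKAGE: the finite group `Gal(K¹(K_{n+t})/K_n)` with its
# abelian normal subgroup `A = Gal(K¹/K_{n+t}) ≅ Cl⁺(K_{n+t})`, a totally ramified inertia generator `g`, the inertia family `𝓘`, and the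
# narrow RANK datum `[G_j : N_j·G_j^p] = [Cl⁺(K_{n+j}) : Cl⁺(K_{n+j})^p]` of every layer

Topic `NumberTheory/IwasawaTheory` (namespace = path). THEOREM-ONLY file (no definition, no named fact, no `sorry`), written by the prover seat
`cruxlead-stmt-BirchSwinnertonDyer-19573-w2` GEN 9 (cell `bsd-2adic`; `--supports` stmt-BirchSwinnertonDyer-19573; closes nothing). Fourth brick of
«NARROW FUKUDA»: the NARROW twin of `Fukuda1994Thm1RankPackage.exists_layer_package` (seat `bsd-potss-k8t-c4` g20, followed line by line).
Differences, all forced by the narrow setting: the Hilbert class field `H_T` of the top layer `T = K_{n+t}` is replaced by the BIG Hilbert class field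
`K¹ = K¹(T) = narrowRayClassField T ⊤` (maximal abelian extension of `T` unramified at every FINITE prime, Galois over `K_n` by
`narrowRayClassField.isGalois_of_isGalois`; Greenberg LNM 1716 p. 122: at `p = 2` over the totally real layers this is the right object); no
`p`-part is taken (`A = Gal(K¹/T)` is the whole `Cl⁺(T)`, of order `h⁺(T)`; the rank step of `FukudaRankGrowthSteps` needs no `p`-group hypothesis
on `A`), and only the RANK data of the layers are exported (`NarrowFukudaRankLayer.exists_layer`). The inertia analysis is verbatim:
`K¹/T` is unramified at the finite primes, so every inertia group `I(𝔔) ≤ Gal(K¹/K_n)` meets `A` trivially and maps injectively to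
`Gal(T/K_n) ≅ ℤ/p^t`, where (Fukuda's index `n₀ ≤ n`, brick (R) `ZpExtension.inertia_layer_eq_bot_or_forall_mem`) it is trivial or everything;
some prime is totally ramified (`ZpExtension.exists_isMaximal_forall_mem_inertia`), giving the generator `g`.

References: [Fukuda1994] Thm. 1 (2), p. 264 (proof); [Washington1997] §13.3 Lemmas 13.14–13.18, Prop. 13.22/13.23; Lemma 13.3;
[NeukirchANT1999] Ch. VI §6 Prop. (6.8); [GreenbergLNM1716] p. 122.
-/

noncomputable section

open scoped NumberField IsMulCommutative
open NumberField IsDedekindDomain Field IntermediateField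

namespace Literature.NumberTheory.IwasawaTheory

open Literature.NumberTheory.EllipticCurves Literature.NumberTheory.GaloisRepresentations
  Literature.NumberTheory.NumberFields

variable {K : Type} [Field K] [NumberField K] {p : ℕ} [hp : Fact p.Prime]

set_option maxHeartbeats 40000000 in
set_option synthInstance.maxHeartbeats 400000 in
/-- **The narrow package.** For a `ℤ_p`-extension `κ` with Fukuda index `n₀ ≤ n` and `t ≥ 1` there are: a finite group `G`
(`= Gal(K¹(K_{n+t})/K_n)`), an abelian normal subgroup `A` of index `p^t` (`= Gal(K¹/K_{n+t}) ≅ Cl⁺(K_{n+t})`), an element `g` with `⟨g⟩ ∩ A = 1`,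
`A⟨g⟩ = G`, and a family `𝓘` of subgroups («inertia groups at the finite primes») with `I ∩ A = 1`, `I = 1 ∨ IA = G`, `⟨g⟩ ∈ 𝓘`, such that for every
`j ≤ t` some subgroup `G_j ⊇ A` of index `p^j` has `[G_j : G_j'·⟨I ∩ G_j⟩·G_j^p] = [Cl⁺(K_{n+j}) : Cl⁺(K_{n+j})^p]` (stated for any `NumberField`
instance on the layer). [cite: Fukuda1994, Thm. 1 (2), p. 264 (proof)] [cite: Washington1997, §13.3 Lemmas 13.15 and 13.18, Prop. 13.23]
[cite: NeukirchANT1999, Ch. VI §6 Prop. (6.8)] [cite: GreenbergLNM1716, §5, proof of Prop. 5.14 (p. 122)] -/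
theorem NarrowFukuda.exists_layer_package (κ : ZpExtension K p) {n₀ n : ℕ} (hκ : TotallyRamifiedFrom κ n₀) (hn : n₀ ≤ n)
    (t : ℕ) (ht : 1 ≤ t) :
    ∃ (G : Type) (_ : Group G) (_ : Finite G) (A : Subgroup G) (_ : A.Normal) (_ : IsMulCommutative A) (g : G)
      (𝓘 : Set (Subgroup G)),
      Subgroup.zpowers g ⊓ A = ⊥ ∧ A ⊔ Subgroup.zpowers g = ⊤ ∧ A.index = p ^ t ∧
      (∀ I ∈ 𝓘, I ⊓ A = ⊥ ∧ (I = ⊥ ∨ I ⊔ A = ⊤)) ∧ Subgroup.zpowers g ∈ 𝓘 ∧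
      ∀ j, j ≤ t → ∀ [NumberField (κ.layer (n + j))], ∃ Gj : Subgroup G, A ≤ Gj ∧ Gj.index = p ^ j ∧
        ((⁅Gj, Gj⁆ ⊔ ⨆ I ∈ 𝓘, I ⊓ Gj) ⊔ Subgroup.closure ((fun x : G => x ^ p) '' (Gj : Set G))).relIndex Gj =
          (powMonoidHom (α := NarrowClassGroup (κ.layer (n + j))) p).range.index := by
  classical
  -- ### the top layer `T = K_{n+t}` as a type; `B = K_n` as an intermediate field of `T/K`
  haveI : FiniteDimensional K (κ.layer n) := κ.finiteDimensional_layer_holds n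
  haveI : FiniteDimensional K (κ.layer (n + t)) := κ.finiteDimensional_layer_holds (n + t)
  haveI : IsGalois K (κ.layer n) := κ.isGalois_layer_holds n
  haveI : IsGalois K (κ.layer (n + t)) := κ.isGalois_layer_holds (n + t)
  haveI : NumberField (κ.layer n) := NumberField.of_module_finite K _
  haveI : NumberField (κ.layer (n + t)) := NumberField.of_module_finite K _
  have hBF : κ.layer n ≤ (κ.layer (n + t)) := κ.layer_mono (Nat.le_add_right n t)
  obtain ⟨Bi, hBi⟩ : ∃ Bi : IntermediateField K (κ.layer (n + t)), Bi = IntermediateField.restrict hBF := ⟨_, rfl⟩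
  let eB : (κ.layer n) ≃ₐ[K] Bi := (IntermediateField.restrict_algEquiv hBF).trans (IntermediateField.equivOfEq hBi.symm)
  haveI : FiniteDimensional K Bi := LinearEquiv.finiteDimensional eB.toLinearEquiv
  haveI : IsGalois K Bi := IsGalois.of_algEquiv eB
  haveI : NumberField Bi := NumberField.of_module_finite K _
  haveI : IsGalois Bi (κ.layer (n + t)) := IsGalois.tower_top_of_isGalois K Bi (κ.layer (n + t))
  have hp0 : 0 < p := hp.out.pos
  have hdegKB : Module.finrank K Bi = p ^ n := by rw [← eB.toLinearEquiv.finrank_eq, κ.finrank_layer_holds n]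
  have hdegBF : Module.finrank Bi (κ.layer (n + t)) = p ^ t := by
    have h := Module.finrank_mul_finrank K Bi (κ.layer (n + t))
    rw [hdegKB, κ.finrank_layer_holds (n + t), pow_add] at h
    exact Nat.eq_of_mul_eq_mul_left (pow_pos hp0 n) h
  -- ### the big Hilbert class field `K¹ = K¹(T)`, Galois over `Bi`
  haveI : IsGalois Bi (narrowRayClassField (κ.layer (n + t)) (top_ne_bot : (⊤ : Ideal (𝓞 (κ.layer (n + t)))) ≠ ⊥)) := narrowRayClassField.isGalois_of_isGalois (K := Bi) (κ.layer (n + t))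
  haveI : FiniteDimensional Bi (narrowRayClassField (κ.layer (n + t)) (top_ne_bot : (⊤ : Ideal (𝓞 (κ.layer (n + t)))) ≠ ⊥)) := Module.Finite.trans (κ.layer (n + t)) (narrowRayClassField (κ.layer (n + t)) (top_ne_bot : (⊤ : Ideal (𝓞 (κ.layer (n + t)))) ≠ ⊥))
  haveI : IsScalarTower Bi (κ.layer (n + t)) (narrowRayClassField (κ.layer (n + t)) (top_ne_bot : (⊤ : Ideal (𝓞 (κ.layer (n + t)))) ≠ ⊥)) := IsScalarTower.of_algebraMap_eq fun _ => rfl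
  -- ### the Galois group `Gp = Gal(K¹/B)`, `A' = Gal(K¹/T) = ker (Gal(K¹/B) → Gal(T/B))`
  obtain ⟨res, hresdef⟩ : ∃ res : ((narrowRayClassField (κ.layer (n + t)) (top_ne_bot : (⊤ : Ideal (𝓞 (κ.layer (n + t)))) ≠ ⊥)) ≃ₐ[Bi] (narrowRayClassField (κ.layer (n + t)) (top_ne_bot : (⊤ : Ideal (𝓞 (κ.layer (n + t)))) ≠ ⊥))) →* ((κ.layer (n + t)) ≃ₐ[Bi] (κ.layer (n + t))), res = AlgEquiv.restrictNormalHom (κ.layer (n + t)) :=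
    ⟨_, rfl⟩
  have hres_surj : Function.Surjective res := by
    rw [hresdef]; exact AlgEquiv.restrictNormalHom_surjective (narrowRayClassField (κ.layer (n + t)) (top_ne_bot : (⊤ : Ideal (𝓞 (κ.layer (n + t)))) ≠ ⊥))
  have hres_apply : ∀ g : (narrowRayClassField (κ.layer (n + t)) (top_ne_bot : (⊤ : Ideal (𝓞 (κ.layer (n + t)))) ≠ ⊥)) ≃ₐ[Bi] (narrowRayClassField (κ.layer (n + t)) (top_ne_bot : (⊤ : Ideal (𝓞 (κ.layer (n + t)))) ≠ ⊥)), res g = g.restrictNormal (κ.layer (n + t)) := fun g => by rw [hresdef]; rfl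
  obtain ⟨A', hA'⟩ : ∃ A' : Subgroup ((narrowRayClassField (κ.layer (n + t)) (top_ne_bot : (⊤ : Ideal (𝓞 (κ.layer (n + t)))) ≠ ⊥)) ≃ₐ[Bi] (narrowRayClassField (κ.layer (n + t)) (top_ne_bot : (⊤ : Ideal (𝓞 (κ.layer (n + t)))) ≠ ⊥))), A' = res.ker := ⟨_, rfl⟩
  haveI hA'n : A'.Normal := by rw [hA']; infer_instance
  have hA'index : A'.index = p ^ t := by
    rw [hA', Subgroup.index_ker, MonoidHom.range_eq_top.mpr hres_surj, Subgroup.card_top, IsGalois.card_aut_eq_finrank, hdegBF]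
  have hcycQ : IsCyclic (((narrowRayClassField (κ.layer (n + t)) (top_ne_bot : (⊤ : Ideal (𝓞 (κ.layer (n + t)))) ≠ ⊥)) ≃ₐ[Bi] (narrowRayClassField (κ.layer (n + t)) (top_ne_bot : (⊤ : Ideal (𝓞 (κ.layer (n + t)))) ≠ ⊥))) ⧸ A') := by
    haveI hcycF : IsCyclic ((κ.layer (n + t)) ≃ₐ[Bi] (κ.layer (n + t))) := by
      obtain ⟨ψ, -, hker, -⟩ := κ.exists_cyclicCharacter_layer (n + t)
      haveI : IsCyclic ((κ.layer (n + t)) ≃ₐ[K] (κ.layer (n + t))) := isCyclic_of_cyclicLayer ψ (κ.layer (n + t)) hker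
      let j : ((κ.layer (n + t)) ≃ₐ[Bi] (κ.layer (n + t))) →* ((κ.layer (n + t)) ≃ₐ[K] (κ.layer (n + t))) :=
        { toFun := fun σ => σ.restrictScalars K
          map_one' := rfl
          map_mul' := fun _ _ => rfl }
      have hj : Function.Injective j := fun σ τ h => AlgEquiv.restrictScalars_injective K h
      exact isCyclic_of_surjective (MonoidHom.ofInjective hj).symm.toMonoidHom (MonoidHom.ofInjective hj).symm.surjective
    exact isCyclic_of_surjective _ (((QuotientGroup.quotientKerEquivOfSurjective res hres_surj).symm.trans
      (QuotientGroup.quotientMulEquivOfEq hA').symm).surjective)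
  have hmemA' : ∀ g : (narrowRayClassField (κ.layer (n + t)) (top_ne_bot : (⊤ : Ideal (𝓞 (κ.layer (n + t)))) ≠ ⊥)) ≃ₐ[Bi] (narrowRayClassField (κ.layer (n + t)) (top_ne_bot : (⊤ : Ideal (𝓞 (κ.layer (n + t)))) ≠ ⊥)), g ∈ A' ↔
      ∀ x : (κ.layer (n + t)), g (algebraMap (κ.layer (n + t)) (narrowRayClassField (κ.layer (n + t)) (top_ne_bot : (⊤ : Ideal (𝓞 (κ.layer (n + t)))) ≠ ⊥)) x) = algebraMap (κ.layer (n + t)) (narrowRayClassField (κ.layer (n + t)) (top_ne_bot : (⊤ : Ideal (𝓞 (κ.layer (n + t)))) ≠ ⊥)) x := by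
    intro g
    rw [hA', MonoidHom.mem_ker]
    constructor
    · intro h x
      have h1 := AlgEquiv.restrictNormal_commutes g (κ.layer (n + t)) x
      rw [← hres_apply, h, AlgEquiv.one_apply] at h1
      exact h1.symm
    · intro h
      apply AlgEquiv.ext
      intro x
      apply (algebraMap (κ.layer (n + t)) (narrowRayClassField (κ.layer (n + t)) (top_ne_bot : (⊤ : Ideal (𝓞 (κ.layer (n + t)))) ≠ ⊥))).injective
      rw [AlgEquiv.one_apply, hres_apply, AlgEquiv.restrictNormal_commutes]
      exact h x
  let ρT : ((narrowRayClassField (κ.layer (n + t)) (top_ne_bot : (⊤ : Ideal (𝓞 (κ.layer (n + t)))) ≠ ⊥)) ≃ₐ[(κ.layer (n + t))] (narrowRayClassField (κ.layer (n + t)) (top_ne_bot : (⊤ : Ideal (𝓞 (κ.layer (n + t)))) ≠ ⊥))) →* ((narrowRayClassField (κ.layer (n + t)) (top_ne_bot : (⊤ : Ideal (𝓞 (κ.layer (n + t)))) ≠ ⊥)) ≃ₐ[Bi] (narrowRayClassField (κ.layer (n + t)) (top_ne_bot : (⊤ : Ideal (𝓞 (κ.layer (n + t)))) ≠ ⊥)))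 :=
    { toFun := fun σ => σ.restrictScalars Bi
      map_one' := rfl
      map_mul' := fun _ _ => rfl }
  have hρT_inj : Function.Injective ρT := fun σ τ h => AlgEquiv.restrictScalars_injective Bi h
  have hρT_range : ρT.range = A' := by
    ext g
    constructor
    · rintro ⟨σ, rfl⟩
      exact (hmemA' _).mpr fun x => σ.commutes x
    · intro hg
      exact ⟨{ g with commutes' := fun x => (hmemA' g).mp hg x }, AlgEquiv.ext fun _ => rfl⟩
  have hA'comm : ∀ a ∈ A', ∀ b ∈ A', a * b = b * a := by
    intro a ha b hb
    rw [← hρT_range] at ha hb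
    obtain ⟨σ, rfl⟩ := ha
    obtain ⟨τ, rfl⟩ := hb
    rw [← map_mul, ← map_mul, (IsAbelianGalois.toIsMulCommutative (K := ↥(κ.layer (n + t))) (L := ↥(narrowRayClassField (κ.layer (n + t)) (top_ne_bot : (⊤ : Ideal (𝓞 (κ.layer (n + t)))) ≠ ⊥)))).is_comm.comm σ τ]
  haveI : IsMulCommutative A' := ⟨⟨fun a b => Subtype.ext (hA'comm a a.2 b b.2)⟩⟩
  -- ### inertia groups: `I(𝔔) ≤ Gp` meets `A'` trivially and is trivial or a complement of `A'`
  have heT : ∀ (Q : Ideal (𝓞 (narrowRayClassField (κ.layer (n + t)) (top_ne_bot : (⊤ : Ideal (𝓞 (κ.layer (n + t)))) ≠ ⊥)))) [Q.IsMaximal], Q.ramificationIdx (𝓞 (κ.layer (n + t))) = 1 := by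
    intro Q hQ
    have hQ0 : Q ≠ ⊥ := Ring.ne_bot_of_isMaximal_of_not_isField hQ (RingOfIntegers.not_isField _)
    haveI : (Q.under (𝓞 (κ.layer (n + t)))).IsMaximal := Ideal.IsMaximal.under (𝓞 (κ.layer (n + t))) Q
    have hv0 : Q.under (𝓞 (κ.layer (n + t))) ≠ ⊥ := mt Ideal.eq_bot_of_comap_eq_bot hQ0
    let v : HeightOneSpectrum (𝓞 (κ.layer (n + t))) := ⟨Q.under (𝓞 (κ.layer (n + t))), inferInstance, hv0⟩
    haveI : Algebra.IsUnramifiedAt (𝓞 (κ.layer (n + t))) Q :=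
      isUnramifiedIn_narrowRayClassField (K := ↥(κ.layer (n + t))) (top_ne_bot : (⊤ : Ideal (𝓞 (κ.layer (n + t)))) ≠ ⊥)
        (fun h => v.isPrime.ne_top (top_le_iff.mp h)) Q inferInstance ⟨rfl⟩
    exact Ideal.ramificationIdx_eq_one Q (𝓞 (κ.layer (n + t)))
  have hcardI : ∀ (Q : Ideal (𝓞 (narrowRayClassField (κ.layer (n + t)) (top_ne_bot : (⊤ : Ideal (𝓞 (κ.layer (n + t)))) ≠ ⊥)))) [Q.IsMaximal],
      Nat.card (Q.inertia ((narrowRayClassField (κ.layer (n + t)) (top_ne_bot : (⊤ : Ideal (𝓞 (κ.layer (n + t)))) ≠ ⊥)) ≃ₐ[Bi] (narrowRayClassField (κ.layer (n + t)) (top_ne_bot : (⊤ : Ideal (𝓞 (κ.layer (n + t)))) ≠ ⊥)))) = Nat.card ((Q.under (𝓞 (κ.layer (n + t)))).inertia ((κ.layer (n + t)) ≃ₐ[Bi] (κ.layer (n + t)))) := by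
    intro Q _
    haveI : (Q.under (𝓞 (κ.layer (n + t)))).IsMaximal := Ideal.IsMaximal.under (𝓞 (κ.layer (n + t))) Q
    rw [card_inertia_eq_ramificationIdx (narrowRayClassField (κ.layer (n + t)) (top_ne_bot : (⊤ : Ideal (𝓞 (κ.layer (n + t)))) ≠ ⊥)) ((narrowRayClassField (κ.layer (n + t)) (top_ne_bot : (⊤ : Ideal (𝓞 (κ.layer (n + t)))) ≠ ⊥)) ≃ₐ[Bi] (narrowRayClassField (κ.layer (n + t)) (top_ne_bot : (⊤ : Ideal (𝓞 (κ.layer (n + t)))) ≠ ⊥))) Bi Q,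
      card_inertia_eq_ramificationIdx (κ.layer (n + t)) ((κ.layer (n + t)) ≃ₐ[Bi] (κ.layer (n + t))) Bi (Q.under (𝓞 (κ.layer (n + t)))),
      Ideal.ramificationIdx_tower (Q.under (𝓞 (κ.layer (n + t)))) Q, heT Q, mul_one]
  have htop_of : ∀ (q : Ideal (𝓞 (κ.layer (n + t)))) [q.IsMaximal],
      (∀ g : (κ.layer (n + t)) ≃ₐ[K] (κ.layer (n + t)), (∀ x : (κ.layer (n + t)), (x : AlgebraicClosure K) ∈ κ.layer n → g x = x) →
        g ∈ q.inertia ((κ.layer (n + t)) ≃ₐ[K] (κ.layer (n + t)))) → q.inertia ((κ.layer (n + t)) ≃ₐ[Bi] (κ.layer (n + t))) = ⊤ := by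
    intro q _ h
    rw [eq_top_iff]
    intro σ _
    have h1 : σ.restrictScalars K ∈ q.inertia ((κ.layer (n + t)) ≃ₐ[K] (κ.layer (n + t))) := by
      apply h
      intro x hx
      have hxB : x ∈ Bi := by rw [hBi, IntermediateField.mem_restrict]; exact hx
      exact σ.commutes ⟨x, hxB⟩
    exact fun y => h1 y
  have hdich : ∀ (q : Ideal (𝓞 (κ.layer (n + t)))) [q.IsMaximal],
      q.inertia ((κ.layer (n + t)) ≃ₐ[Bi] (κ.layer (n + t))) = ⊥ ∨ q.inertia ((κ.layer (n + t)) ≃ₐ[Bi] (κ.layer (n + t))) = ⊤ := by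
    intro q _
    rcases κ.inertia_layer_eq_bot_or_forall_mem hκ hn (Nat.le_add_right n t) q with h1 | h2
    · left
      rw [eq_bot_iff]
      intro σ hσ
      have h3 : σ.restrictScalars K ∈ q.inertia ((κ.layer (n + t)) ≃ₐ[K] (κ.layer (n + t))) := fun y => hσ y
      rw [h1, Subgroup.mem_bot] at h3
      rw [Subgroup.mem_bot]
      apply AlgEquiv.restrictScalars_injective K
      rw [h3]
      rfl
    · exact Or.inr (htop_of q h2)
  have hinf : ∀ (Q : Ideal (𝓞 (narrowRayClassField (κ.layer (n + t)) (top_ne_bot : (⊤ : Ideal (𝓞 (κ.layer (n + t)))) ≠ ⊥)))) [Q.IsMaximal], Q.inertia ((narrowRayClassField (κ.layer (n + t)) (top_ne_bot : (⊤ : Ideal (𝓞 (κ.layer (n + t)))) ≠ ⊥)) ≃ₐ[Bi] (narrowRayClassField (κ.layer (n + t)) (top_ne_bot : (⊤ : Ideal (𝓞 (κ.layer (n + t)))) ≠ ⊥))) ⊓ A' = ⊥ := by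
    intro Q _
    have h1 : (Q.inertia ((narrowRayClassField (κ.layer (n + t)) (top_ne_bot : (⊤ : Ideal (𝓞 (κ.layer (n + t)))) ≠ ⊥)) ≃ₐ[(κ.layer (n + t))] (narrowRayClassField (κ.layer (n + t)) (top_ne_bot : (⊤ : Ideal (𝓞 (κ.layer (n + t)))) ≠ ⊥)))).map ρT = Q.inertia ((narrowRayClassField (κ.layer (n + t)) (top_ne_bot : (⊤ : Ideal (𝓞 (κ.layer (n + t)))) ≠ ⊥)) ≃ₐ[Bi] (narrowRayClassField (κ.layer (n + t)) (top_ne_bot : (⊤ : Ideal (𝓞 (κ.layer (n + t)))) ≠ ⊥))) ⊓ A' := by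
      ext g
      constructor
      · rintro ⟨σ, hσ, rfl⟩
        exact ⟨fun y => hσ y, hρT_range ▸ ⟨σ, rfl⟩⟩
      · rintro ⟨hgI, hgA⟩
        rw [← hρT_range] at hgA
        obtain ⟨σ, rfl⟩ := hgA
        exact ⟨σ, fun y => hgI y, rfl⟩
    rw [← h1, ← Subgroup.card_eq_one, Subgroup.card_map_of_injective hρT_inj,
      card_inertia_eq_ramificationIdx (narrowRayClassField (κ.layer (n + t)) (top_ne_bot : (⊤ : Ideal (𝓞 (κ.layer (n + t)))) ≠ ⊥)) ((narrowRayClassField (κ.layer (n + t)) (top_ne_bot : (⊤ : Ideal (𝓞 (κ.layer (n + t)))) ≠ ⊥)) ≃ₐ[(κ.layer (n + t))] (narrowRayClassField (κ.layer (n + t)) (top_ne_bot : (⊤ : Ideal (𝓞 (κ.layer (n + t)))) ≠ ⊥))) (κ.layer (n + t)) Q, heT Q]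
  have hsup : ∀ (Q : Ideal (𝓞 (narrowRayClassField (κ.layer (n + t)) (top_ne_bot : (⊤ : Ideal (𝓞 (κ.layer (n + t)))) ≠ ⊥)))) [Q.IsMaximal], Nat.card (Q.inertia ((narrowRayClassField (κ.layer (n + t)) (top_ne_bot : (⊤ : Ideal (𝓞 (κ.layer (n + t)))) ≠ ⊥)) ≃ₐ[Bi] (narrowRayClassField (κ.layer (n + t)) (top_ne_bot : (⊤ : Ideal (𝓞 (κ.layer (n + t)))) ≠ ⊥)))) = p ^ t →
      Q.inertia ((narrowRayClassField (κ.layer (n + t)) (top_ne_bot : (⊤ : Ideal (𝓞 (κ.layer (n + t)))) ≠ ⊥)) ≃ₐ[Bi] (narrowRayClassField (κ.layer (n + t)) (top_ne_bot : (⊤ : Ideal (𝓞 (κ.layer (n + t)))) ≠ ⊥))) ⊔ A' = ⊤ := by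
    intro Q _ hc
    have h1 : A'.relIndex (Q.inertia ((narrowRayClassField (κ.layer (n + t)) (top_ne_bot : (⊤ : Ideal (𝓞 (κ.layer (n + t)))) ≠ ⊥)) ≃ₐ[Bi] (narrowRayClassField (κ.layer (n + t)) (top_ne_bot : (⊤ : Ideal (𝓞 (κ.layer (n + t)))) ≠ ⊥))) ⊔ A') = p ^ t := by
      rw [Subgroup.relIndex_sup_right, Subgroup.relIndex,
        Subgroup.subgroupOf_eq_bot.mpr (disjoint_iff.mpr ((inf_comm _ _).trans (hinf Q))), Subgroup.index_bot, hc]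
    have h2 := Subgroup.relIndex_mul_index (le_sup_right : A' ≤ Q.inertia ((narrowRayClassField (κ.layer (n + t)) (top_ne_bot : (⊤ : Ideal (𝓞 (κ.layer (n + t)))) ≠ ⊥)) ≃ₐ[Bi] (narrowRayClassField (κ.layer (n + t)) (top_ne_bot : (⊤ : Ideal (𝓞 (κ.layer (n + t)))) ≠ ⊥))) ⊔ A')
    rw [h1, hA'index] at h2
    exact Subgroup.index_eq_one.mp (Nat.eq_of_mul_eq_mul_left (pow_pos hp0 t) (h2.trans (mul_one _).symm))
  have hcases : ∀ (Q : Ideal (𝓞 (narrowRayClassField (κ.layer (n + t)) (top_ne_bot : (⊤ : Ideal (𝓞 (κ.layer (n + t)))) ≠ ⊥)))) [Q.IsMaximal],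
      Q.inertia ((narrowRayClassField (κ.layer (n + t)) (top_ne_bot : (⊤ : Ideal (𝓞 (κ.layer (n + t)))) ≠ ⊥)) ≃ₐ[Bi] (narrowRayClassField (κ.layer (n + t)) (top_ne_bot : (⊤ : Ideal (𝓞 (κ.layer (n + t)))) ≠ ⊥))) = ⊥ ∨ Q.inertia ((narrowRayClassField (κ.layer (n + t)) (top_ne_bot : (⊤ : Ideal (𝓞 (κ.layer (n + t)))) ≠ ⊥)) ≃ₐ[Bi] (narrowRayClassField (κ.layer (n + t)) (top_ne_bot : (⊤ : Ideal (𝓞 (κ.layer (n + t)))) ≠ ⊥))) ⊔ A' = ⊤ := by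
    intro Q _
    haveI : (Q.under (𝓞 (κ.layer (n + t)))).IsMaximal := Ideal.IsMaximal.under (𝓞 (κ.layer (n + t))) Q
    rcases hdich (Q.under (𝓞 (κ.layer (n + t)))) with h1 | h2
    · left
      rw [← Subgroup.card_eq_one, hcardI Q, h1, Subgroup.card_bot]
    · right
      apply hsup Q
      rw [hcardI Q, h2, Subgroup.card_top, IsGalois.card_aut_eq_finrank, hdegBF]
  have hexists : ∃ (Q : Ideal (𝓞 (narrowRayClassField (κ.layer (n + t)) (top_ne_bot : (⊤ : Ideal (𝓞 (κ.layer (n + t)))) ≠ ⊥)))) (_ : Q.IsMaximal), Q.inertia ((narrowRayClassField (κ.layer (n + t)) (top_ne_bot : (⊤ : Ideal (𝓞 (κ.layer (n + t)))) ≠ ⊥)) ≃ₐ[Bi] (narrowRayClassField (κ.layer (n + t)) (top_ne_bot : (⊤ : Ideal (𝓞 (κ.layer (n + t)))) ≠ ⊥))) ⊔ A' = ⊤ := by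
    obtain ⟨q, hqmax, hq⟩ := κ.exists_isMaximal_forall_mem_inertia hκ hn (Nat.le_add_right n t) (by omega)
    haveI := hqmax
    obtain ⟨Q, hQmax, hQq⟩ := Ideal.exists_maximal_ideal_liesOver_of_isIntegral (S := 𝓞 (narrowRayClassField (κ.layer (n + t)) (top_ne_bot : (⊤ : Ideal (𝓞 (κ.layer (n + t)))) ≠ ⊥))) q
    haveI := hQmax
    refine ⟨Q, hQmax, hsup Q ?_⟩
    rw [hcardI Q, ← hQq.over, htop_of q hq, Subgroup.card_top, IsGalois.card_aut_eq_finrank, hdegBF]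
  -- ### the family `𝓘` of inertia groups, and a generator `g` of a totally ramified one
  obtain ⟨𝓘, h𝓘def⟩ : ∃ 𝓘 : Set (Subgroup ((narrowRayClassField (κ.layer (n + t)) (top_ne_bot : (⊤ : Ideal (𝓞 (κ.layer (n + t)))) ≠ ⊥)) ≃ₐ[Bi] (narrowRayClassField (κ.layer (n + t)) (top_ne_bot : (⊤ : Ideal (𝓞 (κ.layer (n + t)))) ≠ ⊥)))),
      𝓘 = Set.range (fun Q : MaximalSpectrum (𝓞 (narrowRayClassField (κ.layer (n + t)) (top_ne_bot : (⊤ : Ideal (𝓞 (κ.layer (n + t)))) ≠ ⊥))) => Q.asIdeal.inertia ((narrowRayClassField (κ.layer (n + t)) (top_ne_bot : (⊤ : Ideal (𝓞 (κ.layer (n + t)))) ≠ ⊥)) ≃ₐ[Bi] (narrowRayClassField (κ.layer (n + t)) (top_ne_bot : (⊤ : Ideal (𝓞 (κ.layer (n + t)))) ≠ ⊥)))) := ⟨_, rfl⟩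
  have h𝓘 : ∀ I ∈ 𝓘, I ⊓ A' = ⊥ ∧ (I = ⊥ ∨ I ⊔ A' = ⊤) := by
    intro I hI
    rw [h𝓘def] at hI
    obtain ⟨Q, rfl⟩ := hI
    haveI := Q.isMaximal
    exact ⟨hinf Q.asIdeal, hcases Q.asIdeal⟩
  obtain ⟨g, hgA, hgen, hg𝓘⟩ : ∃ g : (narrowRayClassField (κ.layer (n + t)) (top_ne_bot : (⊤ : Ideal (𝓞 (κ.layer (n + t)))) ≠ ⊥)) ≃ₐ[Bi] (narrowRayClassField (κ.layer (n + t)) (top_ne_bot : (⊤ : Ideal (𝓞 (κ.layer (n + t)))) ≠ ⊥)),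
      Subgroup.zpowers g ⊓ A' = ⊥ ∧ A' ⊔ Subgroup.zpowers g = ⊤ ∧ Subgroup.zpowers g ∈ 𝓘 := by
    obtain ⟨Q, hQ, hQsup⟩ := hexists
    haveI := hQ
    have hQinf := hinf Q
    set I₁ := Q.inertia ((narrowRayClassField (κ.layer (n + t)) (top_ne_bot : (⊤ : Ideal (𝓞 (κ.layer (n + t)))) ≠ ⊥)) ≃ₐ[Bi] (narrowRayClassField (κ.layer (n + t)) (top_ne_bot : (⊤ : Ideal (𝓞 (κ.layer (n + t)))) ≠ ⊥))) with hI₁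
    -- `I₁` embeds into the cyclic group `Gp/A'`, hence is cyclic
    let f : I₁ →* ((narrowRayClassField (κ.layer (n + t)) (top_ne_bot : (⊤ : Ideal (𝓞 (κ.layer (n + t)))) ≠ ⊥)) ≃ₐ[Bi] (narrowRayClassField (κ.layer (n + t)) (top_ne_bot : (⊤ : Ideal (𝓞 (κ.layer (n + t)))) ≠ ⊥))) ⧸ A' := (QuotientGroup.mk' A').comp I₁.subtype
    have hf : Function.Injective f := by
      intro x y hxy
      have h1 : ((x : (narrowRayClassField (κ.layer (n + t)) (top_ne_bot : (⊤ : Ideal (𝓞 (κ.layer (n + t)))) ≠ ⊥)) ≃ₐ[Bi] (narrowRayClassField (κ.layer (n + t)) (top_ne_bot : (⊤ : Ideal (𝓞 (κ.layer (n + t)))) ≠ ⊥))))⁻¹ * y ∈ A' := by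
        rw [← QuotientGroup.eq]; exact hxy
      have h2 : ((x : (narrowRayClassField (κ.layer (n + t)) (top_ne_bot : (⊤ : Ideal (𝓞 (κ.layer (n + t)))) ≠ ⊥)) ≃ₐ[Bi] (narrowRayClassField (κ.layer (n + t)) (top_ne_bot : (⊤ : Ideal (𝓞 (κ.layer (n + t)))) ≠ ⊥))))⁻¹ * y ∈ I₁ ⊓ A' := ⟨I₁.mul_mem (I₁.inv_mem x.2) y.2, h1⟩
      rw [hQinf, Subgroup.mem_bot, inv_mul_eq_one] at h2
      exact Subtype.ext h2
    haveI : IsCyclic I₁ :=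
      isCyclic_of_surjective (MonoidHom.ofInjective hf).symm.toMonoidHom (MonoidHom.ofInjective hf).symm.surjective
    obtain ⟨g₀, hg₀⟩ := IsCyclic.exists_generator (α := I₁)
    have hzp : Subgroup.zpowers (g₀ : (narrowRayClassField (κ.layer (n + t)) (top_ne_bot : (⊤ : Ideal (𝓞 (κ.layer (n + t)))) ≠ ⊥)) ≃ₐ[Bi] (narrowRayClassField (κ.layer (n + t)) (top_ne_bot : (⊤ : Ideal (𝓞 (κ.layer (n + t)))) ≠ ⊥))) = I₁ := by
      apply le_antisymm
      · exact (Subgroup.zpowers_le).mpr g₀.2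
      · intro x hx
        obtain ⟨k, hk⟩ := Subgroup.mem_zpowers_iff.mp (hg₀ ⟨x, hx⟩)
        exact Subgroup.mem_zpowers_iff.mpr ⟨k, by rw [← Subgroup.coe_zpow, hk]⟩
    refine ⟨g₀, by rw [hzp]; exact hQinf, by rw [hzp, sup_comm]; exact hQsup, ?_⟩
    rw [hzp, h𝓘def]
    exact ⟨⟨Q, hQ⟩, rfl⟩
  -- ### the layers (`NarrowFukudaRankLayer`) and the package
  have hlayer : ∀ j, j ≤ t → ∀ [NumberField (κ.layer (n + j))], ∃ Gj : Subgroup ((narrowRayClassField (κ.layer (n + t)) (top_ne_bot : (⊤ : Ideal (𝓞 (κ.layer (n + t)))) ≠ ⊥)) ≃ₐ[Bi] (narrowRayClassField (κ.layer (n + t)) (top_ne_bot : (⊤ : Ideal (𝓞 (κ.layer (n + t)))) ≠ ⊥))), A' ≤ Gj ∧ Gj.index = p ^ j ∧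
      ((⁅Gj, Gj⁆ ⊔ ⨆ I ∈ 𝓘, I ⊓ Gj) ⊔ Subgroup.closure ((fun x : (narrowRayClassField (κ.layer (n + t)) (top_ne_bot : (⊤ : Ideal (𝓞 (κ.layer (n + t)))) ≠ ⊥)) ≃ₐ[Bi] (narrowRayClassField (κ.layer (n + t)) (top_ne_bot : (⊤ : Ideal (𝓞 (κ.layer (n + t)))) ≠ ⊥)) => x ^ p) '' (Gj : Set ((narrowRayClassField (κ.layer (n + t)) (top_ne_bot : (⊤ : Ideal (𝓞 (κ.layer (n + t)))) ≠ ⊥)) ≃ₐ[Bi] (narrowRayClassField (κ.layer (n + t)) (top_ne_bot : (⊤ : Ideal (𝓞 (κ.layer (n + t)))) ≠ ⊥)))))).relIndex Gj =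
        (powMonoidHom (α := NarrowClassGroup (κ.layer (n + j))) p).range.index := by
    intro j hj _
    exact NarrowFukuda.exists_layer κ n t j hj Bi hBi hdegKB A' hmemA' 𝓘 h𝓘def
  exact ⟨(narrowRayClassField (κ.layer (n + t)) (top_ne_bot : (⊤ : Ideal (𝓞 (κ.layer (n + t)))) ≠ ⊥)) ≃ₐ[Bi] (narrowRayClassField (κ.layer (n + t)) (top_ne_bot : (⊤ : Ideal (𝓞 (κ.layer (n + t)))) ≠ ⊥)), inferInstance, inferInstance, A', hA'n, inferInstance, g, 𝓘, hgA, hgen, hA'index, h𝓘, hg𝓘, hlayer⟩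

end Literature.NumberTheory.IwasawaTheory

end
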